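import Summits.AnomalousDissipation.AnomalousDissipation.Theses.DopplerClock

/-!
# Route DopplerClock — Assembly (item stmt-AnomalousDissipation-18136)

`Assembly : QuadratureStressFloor → InjectionControlsEnergy → DopplerWorkIdentity → ForceAdmissible →
CruxesGiveTarget → AnomalousDissipation`.

This is verbatim the type of the route's certified deciding theorem
`Summit.AnomalousDissipation.AnomalousDissipation.Theses.DopplerClock.closes`, so the assembly is pure
logic: the glue `CruxesGiveTarget` turns the two cruxes C1 (`QuadratureStressFloor`) and C2
(`InjectionControlsEnergy`) together with the rotation identity `DopplerWorkIdentity` into the pinned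
zeroth law `DopplerZerothLaw` for the swept Doppler pair `f = F sin(2πm x₁) cos(2πn x₂) e₀`, and
`ForceAdmissible` supplies the three admissibility clauses (smooth, divergence free, mean zero) of the
summit statement `AnomalousDissipation` for that one force; the Leray–Hopf family, the energy bound and
the dissipation floor are carried over unchanged. We spell the term out (rather than `exact closes`) so
that the file documents the composition; nothing beyond the five hypotheses is used.
-/

-- `Summit.<Summit>.<Problem>` is the tree's mandated summit-side namespace (CONVENTIONS §2); for this
-- single-conjunct summit the two coincide, so the duplicate is deliberate.
set_option linter.dupNamespace false

namespace Summit.AnomalousDissipation.AnomalousDissipation.Theorems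

open Summit.AnomalousDissipation.AnomalousDissipation.Theses.DopplerClock

/-- **Assembly of route DopplerClock** (item stmt-AnomalousDissipation-18136):
`QuadratureStressFloor → InjectionControlsEnergy → DopplerWorkIdentity → ForceAdmissible →
CruxesGiveTarget → AnomalousDissipation`.
From `CruxesGiveTarget h₁ h₂ hI : DopplerZerothLaw` take `F, V, m, n`, the viscosities `ν j → 0⁺`, the
data `u₀ j` and the global Leray–Hopf solutions `u j` with bounded mean energy and mean dissipation
`≥ ε > 0`; `ForceAdmissible F m n` gives smoothness, solenoidality and zero mean of the force; these are
exactly the clauses of `AnomalousDissipation` for the force `F sin(2πm x₁) cos(2πn x₂) e₀` (the momentum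
clause of the target is simply forgotten). Same term as the route's deciding theorem `closes`.
[folklore] -/
theorem dopplerClockAssembly_proof :
    Summit.AnomalousDissipation.AnomalousDissipation.Theses.DopplerClock.Assembly := by
  unfold Summit.AnomalousDissipation.AnomalousDissipation.Theses.DopplerClock.Assembly
  intro h₁ h₂ hI hA hG
  -- the pinned zeroth law for the swept pair, from the two cruxes through the glue
  obtain ⟨F, V, m, n, _hF, _hV, _hm, _hn, ν, u₀, u, hν, hν0, hLH, _hmom, hE, ε, hε, hεu⟩ := hG h₁ h₂ hI
  -- admissibility of the force `F sin(2πm x₁) cos(2πn x₂) e₀`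
  obtain ⟨hs, hd, hz⟩ := hA F m n
  exact ⟨_, hs, hd, hz, ν, u₀, u, hν, hν0, hLH, hE, ε, hε, hεu⟩

end Summit.AnomalousDissipation.AnomalousDissipation.Theorems
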